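/-
Copyright: cell `pub-ymgap` (HUMAN RULING D-0062), Track A of `YM-PLAN.md`, DAG node N20 (= NE7b); R134 seat `pub-ymgap-dag-n20-d`
(strategy s3 «alternative currency», generation 6), module 10.  Released under the licence of the surrounding project.
-/
import Summits.QuantumFields.YangMills.Theorems.BalabanUVNodesN20ByValueLabelTowerPinned
import HarnessLib

/-!
# YM-DAG node N20 (= NE7b), strategy s3, THE FOURTH CURRENCY «BY VALUE» (module 10): TWO PINNED LEVELS ON BAŁABAN's LABEL TOWER OF RECORD — the
# histories whose level-`k₁` AND level-`k₂` labels pin large-field families weigh, at every later level, at most ONE PEIERLS FACTOR PER PINNED CUBE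
# OF EITHER LEVEL times the whole, unconditionally: the first multi-renewal instance of NE7b's per-class display on the object

Track A of `YM-PLAN.md` (cell `pub-ymgap`, HUMAN RULING D-0062), node **N20** = spine estimate NE7b (`T4WeightBudget.RelWeightBound` — the cell
`pub-balaban`'s OWN estimate, NOT PRINTED in [Bałaban 1983–89], NOT PROVED).  Seat `pub-ymgap-dag-n20-d` (R134, s3), generation 6, module 10 (after 8
`…N20ByValueLadderCells`, 9 `…N20ByValueLabelTowerPinned`).  Kernel theorems only: 0 `def`, 0 `sorry`, standard axioms; COUNT-NEUTRAL (`--supports` K3⁗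
`SpineGivenEndpointR13Sep`, stmt-QuantumFields-20292, `--as helper`).  Restate-immune (no Theses import).

WHY.  Module 9 reduced the class weight of ANY multi-level pinned label pattern on seat n20-c's `labelTowerOfRecord` to the Wilson–Gibbs probability
of the JOINT coarse large-field event of its pinned levels (`sum_admS_integral_labelTower_le_gibbsReal_mul`) and closed ONE pinned level `k`
unconditionally.  NE7b's `W_K < 1, Σ W_K < ∞` is about genealogies that renew MANY times: the quotient must be a PRODUCT of one factor per pinned
level.  THIS FILE types the first such product on the object — two pinned levels `k₁ < k₂` — from module 8's joint two-level sparseness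
(Cauchy–Schwarz over the (LS) ladder):
* §1 ★ `measureReal_forall_exists_and_le_pow` — the counting half of a TWO-FAMILY Peierls argument (generation 3's `measureReal_forall_exists_le_pow`
  with two cell families, two witness types, two rates): one witness per cell in each family, union bound over PAIRS of choice functions,
  `μ{(∀ c ∈ 𝒞₁, ∃ p ∈ cells₁ c, E₁ p) ∧ (∀ c ∈ 𝒞₂, ∃ p ∈ cells₂ c, E₂ p)} ≤ (m₁r₁)^{#𝒞₁}·(m₂r₂)^{#𝒞₂}` from `μ{∀Y₁ ∧ ∀Y₂} ≤ r₁^{#Y₁}r₂^{#Y₂}`.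
* §2 ★ `gibbsMeasure_jointLargeField_dist1_iterAvgFun_le` (module 8 §3 in the SIZE currency), ★★ `gibbsMeasure_jointLargeFieldCells_dist1_iterAvgFun_le`
  — ONE WITNESS PER CELL AT TWO LEVELS `k₁, k₂` JOINTLY under the level-0 lattice Yang–Mills state:
  `μ_β{(∀ c ∈ 𝒞₁, ∃ p ∈ cells₁ c, ε₁ ≤ |Ū^{k₁}(∂p) − 1|) ∧ (∀ c ∈ 𝒞₂, …ε₂…Ū^{k₂}…)} ≤ (m₁e^{C₁δ₀ − δ₀βε₁²∕(2N)})^{#𝒞₁}·(m₂e^{C₂δ₀ − δ₀βε₂²∕(2N)})^{#𝒞₂}`.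
* §3 ★★★ **`sum_admS_integral_le_labelTower_twoLevels_byValue`** — for `k₁ < k₂ < K`, `g₀⁻² ≥ 4N`, the two ζ-laws with (O4)-measurable weights, families
  `D₁`, `D₂` of χ-cubes of levels `k₁ + 1`, `k₂ + 1` with regularity letters on pairwise disjoint regions of `≤ m₁`, `≤ m₂` plaquettes, every cutoff
  `K′ > k₂` and every label-family pattern pinning `D₁` at level `k₁`, `D₂` at level `k₂` and free elsewhere:
  `Σ_{h ∈ admS … K′} ∫ eterm ρ₀ K′ h dμ_{K′} ≤ (m₁e^{C₁δ₀ − δ₀g₀⁻²ε₁²∕(2N)})^{#D₁}·(m₂e^{C₂δ₀ − δ₀g₀⁻²ε₂²∕(2N)})^{#D₂} · ∫ ρ₀ dU₀`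
  (module 9 §2 with `J = {k₁, k₂}` + §2 at levels `k₁ + 1`, `k₂ + 1`); `…_rel` = END2's `extractA` shape.

HONEST FRAMING.  An INSTANCE with LETTER-BASED constants: the common tilt `δ₀` is HALF the smaller of module 7's `δ_{k₁+1}`, `δ_{k₂+1}` (Cauchy–Schwarz) and
these degrade geometrically in the level — `n` pinned levels by the same device divide the tilt by `n`, so this is NOT the level-uniform product a
summable `W_K` needs; the located wall (LEVEL-UNIFORM joint moments = Bałaban's inductive small-field analysis, print's KIND [Balaban1989LargeFieldII]
(1.79) p. 383, NOT print's statement) is untouched and is exactly what this instance does not supply.  Residual binders as in n20-c's modules 28–30 and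
module 9.  Nothing of Bałaban's is asserted; NE7b NOT PRINTED ∕ NOT PROVED; the (α)-instance 0∕1; N20 NOT discharged (typed 28∕28, discharged count
untouched); one finite four-torus programme at fixed `ε` — NOT ℝ⁴, NOT infinite volume, NOT OS, NOT a mass gap, NOT Clay.  References (LOCATORS only; no
decl carries a cite tag): T. Bałaban, CMP **119** (1988) 243–285 [Balaban1988Convergent] ((3.1)–(3.5) pp. 264–265); CMP **122** (1989) 175–202
[Balaban1989LargeFieldI] ((0.1) p. 175); CMP **122** (1989) 355–392 [Balaban1989LargeFieldII] ((1.79), (1.89) pp. 383–387).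
-/

set_option autoImplicit false

noncomputable section

open scoped BigOperators

namespace Summit.QuantumFields.YangMills.BalabanUVNodes.N20ByValueLabelTowerTwoLevels

open MeasureTheory
open Literature.MathematicalPhysics.QuantumFieldTheory.Balaban1983to89
open Literature.MathematicalPhysics.QuantumFieldTheory.Balaban1983to89.T4Continuum
open Literature.MathematicalPhysics.QuantumFieldTheory.Balaban1983to89.Node00
open Summit.QuantumFields.BalabanUV.T4Continuum.B16HistoryReprChain
open Summit.QuantumFields.BalabanUV.T4Continuum.NE7b.PrefixExtraction (admS)
open Summit.QuantumFields.BalabanUV.T4Continuum.ShellMeasureAverageIterate (iterMap)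
open Summit.QuantumFields.YangMills.BalabanUVNodes.N20LCSLabelTower
open Summit.QuantumFields.YangMills.BalabanUVNodes.N20LCSLabelTowerClassWeight (sum_adm_integral_eterm_labelTower)
open Summit.QuantumFields.YangMills.BalabanUVNodes.N20LCSAvgCellPeierls (exp_mul_card_eq_pow)
open Summit.QuantumFields.YangMills.BalabanUVNodes.N20LCSAvgExpMoment (sq_div_le_one_sub_reTr_of_le_dist1)
open Summit.QuantumFields.YangMills.BalabanUVNodes.N20ByValueLadderCells (gibbsMeasure_jointLargeField_iterAvgFun_le)
open Summit.QuantumFields.YangMills.BalabanUVNodes.N20ByValueLabelTowerPinned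
  (sum_admS_integral_labelTower_le_gibbsReal_mul iterMap_avOfRecord_eq)

/-! ## §1 The counting half of a two-family Peierls argument -/

section Counting

variable {Ω : Type*} [MeasurableSpace Ω] (μ : Measure Ω) [IsFiniteMeasure μ]

/-- A choice function of a family of pairwise DISJOINT cells is injective on the cells, so its image has exactly `#𝒞` witnesses. [folklore] -/
theorem card_image_attach_eq {κ π : Type*} [DecidableEq κ] [DecidableEq π] (𝒞 : Finset κ) (cells : κ → Finset π)
    (hdisj : ∀ c₁ ∈ 𝒞, ∀ c₂ ∈ 𝒞, c₁ ≠ c₂ → Disjoint (cells c₁) (cells c₂)) (f : (c : κ) → c ∈ 𝒞 → π)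
    (hf : ∀ (c : κ) (hc : c ∈ 𝒞), f c hc ∈ cells c) :
    (𝒞.attach.image fun c => f c.1 c.2).card = 𝒞.card := by
  have hinj : Set.InjOn (fun c : {c // c ∈ 𝒞} => f c.1 c.2) ↑(𝒞.attach) := by
    intro c₁ _ c₂ _ h
    by_contra hne
    have hne' : c₁.1 ≠ c₂.1 := fun h' => hne (Subtype.ext h')
    have hd := hdisj c₁.1 c₁.2 c₂.1 c₂.2 hne'
    have h1 : f c₁.1 c₁.2 ∈ cells c₁.1 := hf _ _
    have h2 : f c₁.1 c₁.2 ∈ cells c₂.1 := by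
      have := hf c₂.1 c₂.2
      simp only at h
      rwa [← h] at this
    exact Finset.disjoint_left.mp hd h1 h2
  rw [Finset.card_image_of_injOn hinj, Finset.card_attach]

/-- ★ **ONE WITNESS PER CELL IN EACH OF TWO FAMILIES, UNION BOUND OVER PAIRS OF CHOICE FUNCTIONS.**  Let `E₁ p`, `E₂ p` be events, `𝒞₁`, `𝒞₂` finite
families of cells with pairwise disjoint finite witness sets `cells₁ c` (sizes `≤ m₁`), `cells₂ c` (sizes `≤ m₂`), and suppose every pair of finite witness
sets is simultaneously realised with probability `≤ r₁^{#Y₁}·r₂^{#Y₂}` (`r₁, r₂ ≥ 0`).  Then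
`μ{ω | (∀ c ∈ 𝒞₁, ∃ p ∈ cells₁ c, ω ∈ E₁ p) ∧ (∀ c ∈ 𝒞₂, ∃ p ∈ cells₂ c, ω ∈ E₂ p)} ≤ (m₁·r₁)^{#𝒞₁}·(m₂·r₂)^{#𝒞₂}`. [folklore] -/
theorem measureReal_forall_exists_and_le_pow {κ₁ π₁ κ₂ π₂ : Type*} [DecidableEq κ₁] [DecidableEq π₁] [DecidableEq κ₂] [DecidableEq π₂]
    (E₁ : π₁ → Set Ω) (E₂ : π₂ → Set Ω) (𝒞₁ : Finset κ₁) (𝒞₂ : Finset κ₂) (cells₁ : κ₁ → Finset π₁) (cells₂ : κ₂ → Finset π₂)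
    {m₁ m₂ : ℕ} (hm₁ : ∀ c ∈ 𝒞₁, (cells₁ c).card ≤ m₁) (hm₂ : ∀ c ∈ 𝒞₂, (cells₂ c).card ≤ m₂)
    (hdisj₁ : ∀ c₁ ∈ 𝒞₁, ∀ c₂ ∈ 𝒞₁, c₁ ≠ c₂ → Disjoint (cells₁ c₁) (cells₁ c₂))
    (hdisj₂ : ∀ c₁ ∈ 𝒞₂, ∀ c₂ ∈ 𝒞₂, c₁ ≠ c₂ → Disjoint (cells₂ c₁) (cells₂ c₂))
    {r₁ r₂ : ℝ} (hr₁ : 0 ≤ r₁) (hr₂ : 0 ≤ r₂)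
    (hY : ∀ (Y₁ : Finset π₁) (Y₂ : Finset π₂),
      μ.real {ω | (∀ p ∈ Y₁, ω ∈ E₁ p) ∧ ∀ p ∈ Y₂, ω ∈ E₂ p} ≤ r₁ ^ Y₁.card * r₂ ^ Y₂.card) :
    μ.real {ω | (∀ c ∈ 𝒞₁, ∃ p ∈ cells₁ c, ω ∈ E₁ p) ∧ ∀ c ∈ 𝒞₂, ∃ p ∈ cells₂ c, ω ∈ E₂ p} ≤
      ((m₁ : ℝ) * r₁) ^ 𝒞₁.card * (((m₂ : ℝ) * r₂) ^ 𝒞₂.card) := by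
  classical
  -- the pairs of choice functions and their events
  set F := 𝒞₁.pi cells₁ ×ˢ 𝒞₂.pi cells₂ with hF
  let A : ((c : κ₁) → c ∈ 𝒞₁ → π₁) × ((c : κ₂) → c ∈ 𝒞₂ → π₂) → Set Ω := fun f =>
    {ω | (∀ (c : κ₁) (hc : c ∈ 𝒞₁), ω ∈ E₁ (f.1 c hc)) ∧ ∀ (c : κ₂) (hc : c ∈ 𝒞₂), ω ∈ E₂ (f.2 c hc)}
  -- the event lies in the union of the `A f`
  have hsub : {ω | (∀ c ∈ 𝒞₁, ∃ p ∈ cells₁ c, ω ∈ E₁ p) ∧ ∀ c ∈ 𝒞₂, ∃ p ∈ cells₂ c, ω ∈ E₂ p} ⊆ ⋃ f ∈ F, A f := by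
    rintro ω ⟨hω₁, hω₂⟩
    choose g₁ hg₁ hE₁ using hω₁
    choose g₂ hg₂ hE₂ using hω₂
    refine Set.mem_biUnion (x := (g₁, g₂)) (Finset.mem_coe.mpr (Finset.mem_product.mpr
      ⟨Finset.mem_pi.mpr fun c hc => hg₁ c hc, Finset.mem_pi.mpr fun c hc => hg₂ c hc⟩)) ?_
    exact ⟨fun c hc => hE₁ c hc, fun c hc => hE₂ c hc⟩
  -- each `A f` is a simultaneous realisation of `#𝒞₁` distinct level-one and `#𝒞₂` distinct level-two witnesses
  have hA : ∀ f ∈ F, μ.real (A f) ≤ r₁ ^ 𝒞₁.card * r₂ ^ 𝒞₂.card := by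
    intro f hf
    obtain ⟨hf₁, hf₂⟩ := Finset.mem_product.mp hf
    have hfmem₁ : ∀ (c : κ₁) (hc : c ∈ 𝒞₁), f.1 c hc ∈ cells₁ c := fun c hc => Finset.mem_pi.mp hf₁ c hc
    have hfmem₂ : ∀ (c : κ₂) (hc : c ∈ 𝒞₂), f.2 c hc ∈ cells₂ c := fun c hc => Finset.mem_pi.mp hf₂ c hc
    set Y₁ : Finset π₁ := 𝒞₁.attach.image (fun c => f.1 c.1 c.2) with hY₁def
    set Y₂ : Finset π₂ := 𝒞₂.attach.image (fun c => f.2 c.1 c.2) with hY₂def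
    have hAY : A f ⊆ {ω | (∀ p ∈ Y₁, ω ∈ E₁ p) ∧ ∀ p ∈ Y₂, ω ∈ E₂ p} := by
      rintro ω ⟨hω₁, hω₂⟩
      refine ⟨fun p hp => ?_, fun p hp => ?_⟩
      · obtain ⟨c, -, rfl⟩ := Finset.mem_image.mp hp
        exact hω₁ c.1 c.2
      · obtain ⟨c, -, rfl⟩ := Finset.mem_image.mp hp
        exact hω₂ c.1 c.2
    have hY₁card : Y₁.card = 𝒞₁.card := card_image_attach_eq 𝒞₁ cells₁ hdisj₁ f.1 hfmem₁
    have hY₂card : Y₂.card = 𝒞₂.card := card_image_attach_eq 𝒞₂ cells₂ hdisj₂ f.2 hfmem₂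
    calc μ.real (A f) ≤ μ.real {ω | (∀ p ∈ Y₁, ω ∈ E₁ p) ∧ ∀ p ∈ Y₂, ω ∈ E₂ p} := measureReal_mono hAY (measure_ne_top μ _)
      _ ≤ r₁ ^ Y₁.card * r₂ ^ Y₂.card := hY Y₁ Y₂
      _ = r₁ ^ 𝒞₁.card * r₂ ^ 𝒞₂.card := by rw [hY₁card, hY₂card]
  -- the number of pairs of choice functions
  have hFcard : (F.card : ℝ) ≤ (m₁ : ℝ) ^ 𝒞₁.card * (m₂ : ℝ) ^ 𝒞₂.card := by
    have h : F.card ≤ m₁ ^ 𝒞₁.card * m₂ ^ 𝒞₂.card := by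
      rw [hF, Finset.card_product, Finset.card_pi, Finset.card_pi]
      exact Nat.mul_le_mul (Finset.prod_le_pow_card _ _ _ hm₁) (Finset.prod_le_pow_card _ _ _ hm₂)
    exact_mod_cast h
  have hrr : 0 ≤ r₁ ^ 𝒞₁.card * r₂ ^ 𝒞₂.card := mul_nonneg (pow_nonneg hr₁ _) (pow_nonneg hr₂ _)
  calc μ.real {ω | (∀ c ∈ 𝒞₁, ∃ p ∈ cells₁ c, ω ∈ E₁ p) ∧ ∀ c ∈ 𝒞₂, ∃ p ∈ cells₂ c, ω ∈ E₂ p}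
      ≤ μ.real (⋃ f ∈ F, A f) := measureReal_mono hsub (measure_ne_top μ _)
    _ ≤ ∑ f ∈ F, μ.real (A f) := measureReal_biUnion_finset_le _ _
    _ ≤ ∑ _f ∈ F, r₁ ^ 𝒞₁.card * r₂ ^ 𝒞₂.card := Finset.sum_le_sum hA
    _ = F.card * (r₁ ^ 𝒞₁.card * r₂ ^ 𝒞₂.card) := by rw [Finset.sum_const, nsmul_eq_mul]
    _ ≤ ((m₁ : ℝ) ^ 𝒞₁.card * (m₂ : ℝ) ^ 𝒞₂.card) * (r₁ ^ 𝒞₁.card * r₂ ^ 𝒞₂.card) := mul_le_mul_of_nonneg_right hFcard hrr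
    _ = ((m₁ : ℝ) * r₁) ^ 𝒞₁.card * (((m₂ : ℝ) * r₂) ^ 𝒞₂.card) := by rw [mul_pow, mul_pow]; ring

end Counting

/-! ## §2 One witness per cell at two levels, jointly, under the level-0 lattice Yang–Mills state -/

section Cells

variable {N : ℕ} [NeZero N]

/-- ★ **JOINT LARGE-FIELD SPARSENESS OF ANY TWO LEVELS, IN THE SIZE CURRENCY** (module 8's `gibbsMeasure_jointLargeField_iterAvgFun_le` with thresholds
`εᵢ²∕(2N)`, `εᵢ ≥ 0`): prescribed plaquettes `X` of `Ū^{k₁}` AND `Q` of `Ū^{k₂}` all of size `≥ ε₁`, `≥ ε₂` off the identity are jointly rare,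
`≤ e^{C₁δ₀#X + C₂δ₀#Q}·e^{−δ₀β((ε₁²∕(2N))#X + (ε₂²∕(2N))#Q)}`. [folklore] -/
theorem gibbsMeasure_jointLargeField_dist1_iterAvgFun_le (N : ℕ) [NeZero N] (L k₁ k₂ : ℕ) :
    ∃ δ₀ : ℝ, 0 < δ₀ ∧ ∃ C₁ : ℝ, 0 ≤ C₁ ∧ ∃ C₂ : ℝ, 0 ≤ C₂ ∧ ∀ (P : Params), P.d = 4 → P.L = L → k₁ ≤ P.m + P.K → k₂ ≤ P.m + P.K →
      ∀ (β : ℝ), 4 * N ≤ β → ∀ (ε₁ ε₂ : ℝ), 0 ≤ ε₁ → 0 ≤ ε₂ → ∀ (X : Finset (Plaq P k₁)) (Q : Finset (Plaq P k₂)),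
        (T4GenFunBounds.gibbsMeasure P β : Measure (GaugeField P 0 (Matrix.specialUnitaryGroup (Fin N) ℂ))).real
            {U | (∀ q ∈ X, ε₁ ≤ dist1 (GaugeField.plaqHol
                (Averaging.iter (fun _ => BlockAveraging.blockAvg (ExpMeanLog.expMeanLogSU (n := Fin N))) k₁ U) q)) ∧
              ∀ p ∈ Q, ε₂ ≤ dist1 (GaugeField.plaqHol
                (Averaging.iter (fun _ => BlockAveraging.blockAvg (ExpMeanLog.expMeanLogSU (n := Fin N))) k₂ U) p)} ≤
          Real.exp (C₁ * δ₀ * X.card + C₂ * δ₀ * Q.card) *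
            Real.exp (-(δ₀ * β * ((ε₁ ^ 2 / (2 * (Fintype.card (Fin N) : ℝ))) * X.card +
              (ε₂ ^ 2 / (2 * (Fintype.card (Fin N) : ℝ))) * Q.card))) := by
  obtain ⟨δ₀, hδ₀, C₁, hC₁, C₂, hC₂, h⟩ := gibbsMeasure_jointLargeField_iterAvgFun_le N L k₁ k₂
  refine ⟨δ₀, hδ₀, C₁, hC₁, C₂, hC₂, fun P hd hL hk₁ hk₂ β hβ ε₁ ε₂ hε₁ hε₂ X Q => ?_⟩
  have hNpos : (0 : ℝ) < N := Nat.cast_pos.mpr (Nat.pos_of_ne_zero (NeZero.ne N))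
  have hβ0 : 0 ≤ β := le_trans (by positivity) hβ
  haveI := T4GenFunBounds.isProbabilityMeasure_gibbsMeasure (G := Matrix.specialUnitaryGroup (Fin N) ℂ) P hβ0
  have hsub : {U : GaugeField P 0 (Matrix.specialUnitaryGroup (Fin N) ℂ) |
        (∀ q ∈ X, ε₁ ≤ dist1 (GaugeField.plaqHol
          (Averaging.iter (fun _ => BlockAveraging.blockAvg (ExpMeanLog.expMeanLogSU (n := Fin N))) k₁ U) q)) ∧
        ∀ p ∈ Q, ε₂ ≤ dist1 (GaugeField.plaqHol
          (Averaging.iter (fun _ => BlockAveraging.blockAvg (ExpMeanLog.expMeanLogSU (n := Fin N))) k₂ U) p)} ⊆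
      {U | (∀ q ∈ X, ε₁ ^ 2 / (2 * (Fintype.card (Fin N) : ℝ)) ≤ 1 - reTr (GaugeField.plaqHol
          (Averaging.iter (fun _ => BlockAveraging.blockAvg (ExpMeanLog.expMeanLogSU (n := Fin N))) k₁ U) q)) ∧
        ∀ p ∈ Q, ε₂ ^ 2 / (2 * (Fintype.card (Fin N) : ℝ)) ≤ 1 - reTr (GaugeField.plaqHol
          (Averaging.iter (fun _ => BlockAveraging.blockAvg (ExpMeanLog.expMeanLogSU (n := Fin N))) k₂ U) p)} :=
    fun U hU => ⟨fun q hq => sq_div_le_one_sub_reTr_of_le_dist1 _ hε₁ (hU.1 q hq),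
      fun p hp => sq_div_le_one_sub_reTr_of_le_dist1 _ hε₂ (hU.2 p hp)⟩
  exact (measureReal_mono hsub (measure_ne_top _ _)).trans (h P hd hL hk₁ hk₂ β hβ _ _ X Q)

/-- Regrouping the joint bound as a product of two geometric weights. [folklore] -/
theorem exp_pair_eq_pow_mul_pow (C₁ C₂ δ₀ β a₁ a₂ : ℝ) (n₁ n₂ : ℕ) :
    Real.exp (C₁ * δ₀ * n₁ + C₂ * δ₀ * n₂) * Real.exp (-(δ₀ * β * (a₁ * n₁ + a₂ * n₂))) =
      Real.exp (C₁ * δ₀ - δ₀ * β * a₁) ^ n₁ * Real.exp (C₂ * δ₀ - δ₀ * β * a₂) ^ n₂ := by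
  rw [← exp_mul_card_eq_pow, ← exp_mul_card_eq_pow, ← Real.exp_add, ← Real.exp_add, ← Real.exp_add, ← Real.exp_add]
  congr 1
  ring

/-- ★★ **ONE WITNESS PER CELL AT TWO LEVELS, JOINTLY** (size currency): with the `δ₀ > 0`, `C₁, C₂ ≥ 0` of
`gibbsMeasure_jointLargeField_dist1_iterAvgFun_le`, for every `d = 4` parameter set `P` (`P.L = L`, `k₁, k₂ ≤ m + K`), every `β ≥ 4N`, thresholds
`ε₁, ε₂ ≥ 0`, and two finite families of cells with pairwise disjoint witness sets of `≤ m₁` level-`k₁` resp. `≤ m₂` level-`k₂` plaquettes,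
`μ_β{(∀ c ∈ 𝒞₁, ∃ p ∈ cells₁ c, ε₁ ≤ |Ū^{k₁}(∂p) − 1|) ∧ (∀ c ∈ 𝒞₂, ∃ p ∈ cells₂ c, ε₂ ≤ |Ū^{k₂}(∂p) − 1|)}
   ≤ (m₁·e^{C₁δ₀ − δ₀βε₁²∕(2N)})^{#𝒞₁} · (m₂·e^{C₂δ₀ − δ₀βε₂²∕(2N)})^{#𝒞₂}`
— one Peierls factor per pinned cube at EACH of the two levels (§1's counting over the pair bound). [folklore] -/
theorem gibbsMeasure_jointLargeFieldCells_dist1_iterAvgFun_le (N : ℕ) [NeZero N] (L k₁ k₂ : ℕ) :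
    ∃ δ₀ : ℝ, 0 < δ₀ ∧ ∃ C₁ : ℝ, 0 ≤ C₁ ∧ ∃ C₂ : ℝ, 0 ≤ C₂ ∧ ∀ (P : Params), P.d = 4 → P.L = L → k₁ ≤ P.m + P.K → k₂ ≤ P.m + P.K →
      ∀ (β : ℝ), 4 * N ≤ β → ∀ (ε₁ ε₂ : ℝ), 0 ≤ ε₁ → 0 ≤ ε₂ →
      ∀ {κ₁ κ₂ : Type} [DecidableEq κ₁] [DecidableEq κ₂] (𝒞₁ : Finset κ₁) (𝒞₂ : Finset κ₂)
        (cells₁ : κ₁ → Finset (Plaq P k₁)) (cells₂ : κ₂ → Finset (Plaq P k₂)) (m₁ m₂ : ℕ),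
        (∀ c ∈ 𝒞₁, (cells₁ c).card ≤ m₁) → (∀ c ∈ 𝒞₂, (cells₂ c).card ≤ m₂) →
        (∀ c₁ ∈ 𝒞₁, ∀ c₂ ∈ 𝒞₁, c₁ ≠ c₂ → Disjoint (cells₁ c₁) (cells₁ c₂)) →
        (∀ c₁ ∈ 𝒞₂, ∀ c₂ ∈ 𝒞₂, c₁ ≠ c₂ → Disjoint (cells₂ c₁) (cells₂ c₂)) →
        (T4GenFunBounds.gibbsMeasure P β : Measure (GaugeField P 0 (Matrix.specialUnitaryGroup (Fin N) ℂ))).real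
            {U | (∀ c ∈ 𝒞₁, ∃ p ∈ cells₁ c, ε₁ ≤ dist1 (GaugeField.plaqHol
                (Averaging.iter (fun _ => BlockAveraging.blockAvg (ExpMeanLog.expMeanLogSU (n := Fin N))) k₁ U) p)) ∧
              ∀ c ∈ 𝒞₂, ∃ p ∈ cells₂ c, ε₂ ≤ dist1 (GaugeField.plaqHol
                (Averaging.iter (fun _ => BlockAveraging.blockAvg (ExpMeanLog.expMeanLogSU (n := Fin N))) k₂ U) p)} ≤
          ((m₁ : ℝ) * Real.exp (C₁ * δ₀ - δ₀ * β * (ε₁ ^ 2 / (2 * (Fintype.card (Fin N) : ℝ))))) ^ 𝒞₁.card *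
            ((m₂ : ℝ) * Real.exp (C₂ * δ₀ - δ₀ * β * (ε₂ ^ 2 / (2 * (Fintype.card (Fin N) : ℝ))))) ^ 𝒞₂.card := by
  classical
  obtain ⟨δ₀, hδ₀, C₁, hC₁, C₂, hC₂, h⟩ := gibbsMeasure_jointLargeField_dist1_iterAvgFun_le N L k₁ k₂
  refine ⟨δ₀, hδ₀, C₁, hC₁, C₂, hC₂,
    fun P hd hL hk₁ hk₂ β hβ ε₁ ε₂ hε₁ hε₂ κ₁ κ₂ _ _ 𝒞₁ 𝒞₂ cells₁ cells₂ m₁ m₂ hm₁ hm₂ hdisj₁ hdisj₂ => ?_⟩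
  have hNpos : (0 : ℝ) < N := Nat.cast_pos.mpr (Nat.pos_of_ne_zero (NeZero.ne N))
  have hβ0 : 0 ≤ β := le_trans (by positivity) hβ
  haveI := T4GenFunBounds.isProbabilityMeasure_gibbsMeasure (G := Matrix.specialUnitaryGroup (Fin N) ℂ) P hβ0
  refine measureReal_forall_exists_and_le_pow _
    (fun p => {U : GaugeField P 0 (Matrix.specialUnitaryGroup (Fin N) ℂ) | ε₁ ≤ dist1 (GaugeField.plaqHol
      (Averaging.iter (fun _ => BlockAveraging.blockAvg (ExpMeanLog.expMeanLogSU (n := Fin N))) k₁ U) p)})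
    (fun p => {U : GaugeField P 0 (Matrix.specialUnitaryGroup (Fin N) ℂ) | ε₂ ≤ dist1 (GaugeField.plaqHol
      (Averaging.iter (fun _ => BlockAveraging.blockAvg (ExpMeanLog.expMeanLogSU (n := Fin N))) k₂ U) p)})
    𝒞₁ 𝒞₂ cells₁ cells₂ hm₁ hm₂ hdisj₁ hdisj₂ (Real.exp_pos _).le (Real.exp_pos _).le fun Y₁ Y₂ => ?_
  rw [← exp_pair_eq_pow_mul_pow]
  exact h P hd hL hk₁ hk₂ β hβ ε₁ ε₂ hε₁ hε₂ Y₁ Y₂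

end Cells

/-! ## §3 Two pinned levels on the label tower of record, unconditionally -/

section TwoLevels

variable (F : T4Family) (N : ℕ) [NeZero N] (ν : Stage7Numerics) (M : ℕ) (p : B12.RunParams) (g : ℕ → ℝ)

open Classical in
/-- ★★★ **KEYS PINNED AT TWO LEVELS `k₁ < k₂` ON BAŁABAN's LABEL TOWER, BY VALUE.**  For every `N ≥ 1`, torus family `F` and levels `k₁`, `k₂` there are
`δ₀ > 0`, `C₁, C₂ ≥ 0` (§2's constants at levels `k₁ + 1`, `k₂ + 1`, functions of `N`, `F.L`, `k₁`, `k₂`) such that: for `k₁ < k₂ < K`, `g₀⁻² ≥ 4N`,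
every `E₀`, `A₁`, every `ζ` obeying the two displayed laws with (O4)-measurable label weights, finite families `D₁` of χ_{k₁+1}-cubes and `D₂` of
χ_{k₂+1}-cubes with regularity letters on pairwise disjoint regions `R₁ c` (`≤ m₁` plaquettes), `R₂ c` (`≤ m₂` plaquettes), thresholds `ε₁, ε₂ ≥ 0`, every
cutoff `K′ > k₂` and every label-family pattern `E` pinning `D₁` at level `k₁` and `D₂` at level `k₂` (`t ∈ E kᵢ h → Dᵢ ⊆ P(t)`) and free at every other
level:
`Σ_{h ∈ admS (labelTowerOfRecord A₁ ζ) (labelPattern E) K′} ∫ eterm ρ₀ K′ h dμ_{K′}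
   ≤ (m₁·e^{C₁δ₀ − δ₀g₀⁻²ε₁²∕(2N)})^{#D₁} · (m₂·e^{C₂δ₀ − δ₀g₀⁻²ε₂²∕(2N)})^{#D₂} · ∫ ρ₀ dU₀`
— the histories whose level-`k₁` AND level-`k₂` labels pin the families large weigh, at every later level, at most ONE PEIERLS FACTOR PER PINNED CUBE OF
EITHER LEVEL times the whole: module 9's reduction with `J = {k₁, k₂}` and §2 at levels `k₁ + 1`, `k₂ + 1`. [folklore] -/
theorem sum_admS_integral_le_labelTower_twoLevels_byValue (k₁ k₂ : ℕ) :
    ∃ δ₀ : ℝ, 0 < δ₀ ∧ ∃ C₁ : ℝ, 0 ≤ C₁ ∧ ∃ C₂ : ℝ, 0 ≤ C₂ ∧ ∀ (_hk : k₁ < k₂) (_hK : k₂ < p.K) (g₀ E₀ : ℝ), 4 * N ≤ g₀⁻¹ ^ 2 →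
      ∀ (A₁ : ℝ) {ζ : ZetaOfRecord F N ν M}, IsZetaUnity F N ν M ζ → IsZetaAbsLeOne F N ν M ζ →
      (∀ (k : ℕ) (s : SeqOfRecord F ν M g p.K k) (t : LbOfRecord F ν p g k),
        Measurable fun z : cfgOfRecord F N p.K (k + 1) × cfgOfRecord F N p.K k => ωOfRecord F N ν M p g k A₁ ζ s t z.2 z.1) →
      ∀ (D₁ : Finset (Iχ F ν p g k₁)) (R₁ : Iχ F ν p g k₁ → Finset (Plaq (F.P p.K) (k₁ + 1))) (m₁ : ℕ) (ε₁ : ℝ), 0 ≤ ε₁ →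
        (∀ c ∈ D₁, (R₁ c).card ≤ m₁) → (∀ c₁ ∈ D₁, ∀ c₂ ∈ D₁, c₁ ≠ c₂ → Disjoint (R₁ c₁) (R₁ c₂)) →
        (∀ c ∈ D₁, ∀ V' : GaugeField (F.P p.K) (k₁ + 1) (SU N),
          (∀ p' ∈ R₁ c, dist1 (GaugeField.plaqHol V' p') < ε₁) → chiFactor F N ν p g k₁ c V' = 1) →
      ∀ (D₂ : Finset (Iχ F ν p g k₂)) (R₂ : Iχ F ν p g k₂ → Finset (Plaq (F.P p.K) (k₂ + 1))) (m₂ : ℕ) (ε₂ : ℝ), 0 ≤ ε₂ →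
        (∀ c ∈ D₂, (R₂ c).card ≤ m₂) → (∀ c₁ ∈ D₂, ∀ c₂ ∈ D₂, c₁ ≠ c₂ → Disjoint (R₂ c₁) (R₂ c₂)) →
        (∀ c ∈ D₂, ∀ V' : GaugeField (F.P p.K) (k₂ + 1) (SU N),
          (∀ p' ∈ R₂ c, dist1 (GaugeField.plaqHol V' p') < ε₂) → chiFactor F N ν p g k₂ c V' = 1) →
      ∀ (K' : ℕ), k₂ < K' → ∀ (E : (j : ℕ) → (Fin j → LabelPat F ν p g) → Finset (LbOfRecord F ν p g j)),
        (∀ h t, t ∈ E k₁ h → D₁ ⊆ t.1) → (∀ h t, t ∈ E k₂ h → D₂ ⊆ t.1) → (∀ j h, j ≠ k₁ → j ≠ k₂ → E j h = Finset.univ) →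
        ∑ h ∈ admS (labelTowerOfRecord F N ν M p g A₁ ζ) (labelPattern F ν p g E) K',
            ∫ x, (labelTowerOfRecord F N ν M p g A₁ ζ).eterm (rhoZeroOfRecord F N p.K g₀ E₀) K' h x ∂(lawOfRecord F N p.K K') ≤
          (((m₁ : ℝ) * Real.exp (C₁ * δ₀ - δ₀ * g₀⁻¹ ^ 2 * (ε₁ ^ 2 / (2 * (Fintype.card (Fin N) : ℝ))))) ^ D₁.card *
            ((m₂ : ℝ) * Real.exp (C₂ * δ₀ - δ₀ * g₀⁻¹ ^ 2 * (ε₂ ^ 2 / (2 * (Fintype.card (Fin N) : ℝ))))) ^ D₂.card) *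
            ∫ U, rhoZeroOfRecord F N p.K g₀ E₀ U ∂(fieldMeasure (F.P p.K) 0 (SU N)) := by
  obtain ⟨δ₀, hδ₀, C₁, hC₁, C₂, hC₂, h2⟩ := gibbsMeasure_jointLargeFieldCells_dist1_iterAvgFun_le N F.L (k₁ + 1) (k₂ + 1)
  refine ⟨δ₀, hδ₀, C₁, hC₁, C₂, hC₂, fun hk hK g₀ E₀ hg A₁ ζ hζu hζ hω D₁ R₁ m₁ ε₁ hε₁ hm₁ hdisj₁ hreg₁ D₂ R₂ m₂ ε₂ hε₂ hm₂ hdisj₂ hreg₂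
    K' hK' E hE₁ hE₂ hEfree => ?_⟩
  have hne : k₁ ≠ k₂ := Nat.ne_of_lt hk
  -- the two pinned levels as level-indexed families
  set D' : (j : ℕ) → Finset (Iχ F ν p g j) := Function.update (Function.update (fun _ => ∅) k₁ D₁) k₂ D₂ with hD'def
  set R' : (j : ℕ) → Iχ F ν p g j → Finset (Plaq (F.P p.K) (j + 1)) :=
    Function.update (Function.update (fun _ _ => ∅) k₁ R₁) k₂ R₂ with hR'def
  set ε : ℕ → ℝ := Function.update (Function.update (fun _ => 0) k₁ ε₁) k₂ ε₂ with hεdef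
  have hD'₁ : D' k₁ = D₁ := by rw [hD'def, Function.update_of_ne hne, Function.update_self]
  have hD'₂ : D' k₂ = D₂ := by rw [hD'def, Function.update_self]
  have hR'₁ : R' k₁ = R₁ := by rw [hR'def, Function.update_of_ne hne, Function.update_self]
  have hR'₂ : R' k₂ = R₂ := by rw [hR'def, Function.update_self]
  have hε₁' : ε k₁ = ε₁ := by rw [hεdef, Function.update_of_ne hne, Function.update_self]
  have hε₂' : ε k₂ = ε₂ := by rw [hεdef, Function.update_self]
  have hreg' : ∀ j ∈ ({k₁, k₂} : Finset ℕ), ∀ c ∈ D' j, ∀ V' : GaugeField (F.P p.K) (j + 1) (SU N),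
      (∀ p' ∈ R' j c, dist1 (GaugeField.plaqHol V' p') < ε j) → chiFactor F N ν p g j c V' = 1 := by
    intro j hj
    rcases Finset.mem_insert.1 hj with hj₁ | hj₂
    · subst hj₁
      rw [hD'₁, hR'₁, hε₁']
      exact hreg₁
    · rw [Finset.mem_singleton] at hj₂
      subst hj₂
      rw [hD'₂, hR'₂, hε₂']
      exact hreg₂
  have hEpin : ∀ j ∈ ({k₁, k₂} : Finset ℕ), ∀ h t, t ∈ E j h → D' j ⊆ t.1 := by
    intro j hj
    rcases Finset.mem_insert.1 hj with hj₁ | hj₂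
    · subst hj₁
      rw [hD'₁]
      exact hE₁
    · rw [Finset.mem_singleton] at hj₂
      subst hj₂
      rw [hD'₂]
      exact hE₂
  have hEfree' : ∀ j, j ∉ ({k₁, k₂} : Finset ℕ) → ∀ h, E j h = Finset.univ := by
    intro j hj h
    have h₁ : j ≠ k₁ := fun e => hj (Finset.mem_insert.2 (Or.inl e))
    have h₂ : j ≠ k₂ := fun e => hj (Finset.mem_insert.2 (Or.inr (Finset.mem_singleton.2 e)))
    exact hEfree j h h₁ h₂
  have key := sum_admS_integral_labelTower_le_gibbsReal_mul F N ν M p g g₀ E₀ A₁ hζu hζ hω {k₁, k₂} D' R' ε hreg' E hEpin hEfree' K'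
  refine key.trans (mul_le_mul_of_nonneg_right ?_ (integral_nonneg fun U => (rhoZeroOfRecord_pos F N p.K g₀ E₀ U).le))
  -- the joint event of the two pinned levels is the two-family cells event of `Ū^{k₁+1}`, `Ū^{k₂+1}`
  have hk₁K : k₁ < K' := hk.trans hK'
  have hsub : {U : cfgOfRecord F N p.K 0 | ∀ j ∈ ({k₁, k₂} : Finset ℕ), j < K' → ∀ c ∈ D' j, ∃ p' ∈ R' j c,
        ε j ≤ dist1 (GaugeField.plaqHol (iterMap (fun i => (avOfRecord F N p.K i).avg) (j + 1) U) p')} ⊆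
      {U : GaugeField (F.P p.K) 0 (Matrix.specialUnitaryGroup (Fin N) ℂ) |
        (∀ c ∈ D₁, ∃ p' ∈ R₁ c, ε₁ ≤ dist1 (GaugeField.plaqHol
          (Averaging.iter (fun _ => BlockAveraging.blockAvg (ExpMeanLog.expMeanLogSU (n := Fin N))) (k₁ + 1) U) p')) ∧
        ∀ c ∈ D₂, ∃ p' ∈ R₂ c, ε₂ ≤ dist1 (GaugeField.plaqHol
          (Averaging.iter (fun _ => BlockAveraging.blockAvg (ExpMeanLog.expMeanLogSU (n := Fin N))) (k₂ + 1) U) p')} := by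
    intro U hU
    have hU₁ := hU k₁ (Finset.mem_insert_self k₁ {k₂}) hk₁K
    have hU₂ := hU k₂ (Finset.mem_insert.2 (Or.inr (Finset.mem_singleton_self k₂))) hK'
    rw [hD'₁] at hU₁
    rw [hD'₂] at hU₂
    refine ⟨fun c hc => ?_, fun c hc => ?_⟩
    · obtain ⟨p', hp', hle⟩ := hU₁ c hc
      refine ⟨p', by rw [hR'₁] at hp'; exact hp', ?_⟩
      rw [hε₁', iterMap_avOfRecord_eq] at hle
      exact hle
    · obtain ⟨p', hp', hle⟩ := hU₂ c hc
      refine ⟨p', by rw [hR'₂] at hp'; exact hp', ?_⟩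
      rw [hε₂', iterMap_avOfRecord_eq] at hle
      exact hle
  have hmK₁ : k₁ + 1 ≤ (F.P p.K).m + (F.P p.K).K := by
    simp only [T4Family.P_m, T4Family.P_K]; omega
  have hmK₂ : k₂ + 1 ≤ (F.P p.K).m + (F.P p.K).K := by
    simp only [T4Family.P_m, T4Family.P_K]; omega
  haveI := T4GenFunBounds.isProbabilityMeasure_gibbsMeasure (G := SU N) (F.P p.K) (sq_nonneg g₀⁻¹)
  exact (measureReal_mono hsub (measure_ne_top _ _)).trans
    (h2 (F.P p.K) (T4Family.P_d F p.K) (T4Family.P_L F p.K) hmK₁ hmK₂ (g₀⁻¹ ^ 2) hg ε₁ ε₂ hε₁ hε₂ D₁ D₂ R₁ R₂ m₁ m₂ hm₁ hm₂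
      hdisj₁ hdisj₂)

end TwoLevels

end Summit.QuantumFields.YangMills.BalabanUVNodes.N20ByValueLabelTowerTwoLevels

end
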